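import Summits.BirchSwinnertonDyer.BirchSwinnertonDyer.Theorems.PrintCFramBottomClassIndexLawFiveLeEisensteinEndStateV19Binders
import Summits.BirchSwinnertonDyer.BirchSwinnertonDyer.Theorems.PrintCFramBottomClassIndexLawFiveLeHeegnerTwistShaSupply
import Summits.BirchSwinnertonDyer.BirchSwinnertonDyer.Theorems.PrintCFramBottomClassIndexLawFiveLeHeegnerTwistShaOfUnit
import Summits.BirchSwinnertonDyer.BirchSwinnertonDyer.Theorems.PrintCFramBottomClassIndexLawFiveLeHeegnerTwistShaAnSupply
import HarnessLib

/-!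
# Route `PrintCFram`, crux C2 `BottomClassIndexLawFiveLe` (stmt-BirchSwinnertonDyer-20372), line `eisenstein-resource-bdp-line`
# (registry v19): **END STATE v19 IN Ш-CURRENCY** — crux ⟸ prints4 ∧ Mazur–Wiles Thm 2 ∧ Kriz–Li Thm 1.20 ∧ **C_Ш** ∧ **B1-level** ∧ **B1-sha**,
# all three research residues stated on CLASS MEMBERS with `Ш[p]` and the level only; and the dictionary
# «unit `K''`-factor ⟺ `Ш[p]`-trivial Heegner twist pair»
# (cell `bsd-print-cfram`, width seat `bsd-line-cfram-p1-w5` g4; THEOREMS ONLY, `--supports` 20372; BSD is not proved by any of this)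

HONEST FRAMING. Nothing about BSD is proved here and no stub is closed: like LEAD g11's `…EisensteinEndStateV19Binders` (B1 ⟺ B1-level ∧
B1-sha) and `…V19CurveFree` (C ⟸ w8 g4's curve-free (P)), this file only RE-READS registry v19's research stubs. The C slot is fed by
this seat's `HeegnerTwistSha.stubC_of_heegnerTwistShaSupply` (C VERBATIM ⟸ C_Ш), so that the END STATE carries, besides four refereed
print facts + Mazur–Wiles Thm. 2 + Kriz–Li Thm. 1.20, exactly three hypotheses about the CM-ramified class itself:
* **C_Ш** — every rank-one class member `W` has an imaginary quadratic `K''`, Heegner for `N_W`, `d_{K''}` odd `< −4`, with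
  `L(W^{(d_{K''})},1) ≠ 0` and a globally minimal model `Wd` of the twist such that `Ш(Wd)[p] = 0` and `Ш(W₁)[p] = 0` for every globally
  minimal CM-ramified `p`-isogenous partner `W₁` of `Wd` («one good Heegner twist pair»; the class is closed under admissible twists,
  w3 g9 `ParitySplit.hasCM_and_cmRamified_of_smul_quadraticTwist`);
* **B1-level** — `BSD_p(W)` for the rank-one members whose generator is `p`-divisible in `W(ℚ_p)`;
* **B1-sha** — `BSD_p(W)` for the rank-one members with `Ш(W)[p] ≠ 0`.

* §1 **`unit_fieldFactor_iff_twist_noPTorsion_pair`** — for a class member with odd datum, an imaginary quadratic `K''` with Kronecker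
  `ε`, and a globally minimal twist model `Wd` with `L(W^{(d)},1) ≠ 0`: «unit field factor `¬ ‖B_{1,(ψεω⁻¹)~}‖ ≤ p⁻¹` ⟺ `Ш[p]`-trivial
  twist pair» (⟹ this seat's `twist_noPTorsion_pair_of_unit_fieldFactor`, CT + GZK; ⟸ `not_fieldFactor_le_of_twist_noPTorsion_pair`,
  MW + GZK). Registry v19's Stub C and C_Ш♭ (`stubC_of_heegnerTwistShaSupply_binders`) thus differ by a conclusion rewritten along an
  IFF, up to the clause `L(W^{(d)},1) ≠ 0` (which C's consumer gets from Kriz–Li Thm. 1.20 + Gross–Zagier anyway).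
* §2 **`bottomClassIndexLawFiveLe_of_prints4_of_mazurWiles_of_krizLi_of_shaSupply_of_level_of_sha`** — THE END STATE IN Ш-CURRENCY,
  one line through LEAD g11's `EisensteinEndStateV19Binders.bottomClassIndexLawFiveLe_of_prints4_of_mazurWiles_of_krizLi_of_cover_of_level_of_sha`
  with the C slot fed by `stubC_of_heegnerTwistShaSupply` (GZK read off `prints4` by `InputsPrints.prints7_of_prints4`);
  `…_of_shaSupplyIsogenyClass_…` — the same with the isogeny-class form of C_Ш.
* §3 `bottomClassIndexLawFiveLe_of_prints4_of_mazurWiles_of_krizLi_of_shaAnSupply_of_level_of_sha` — the END STATE in `L`-VALUE currency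
  (C slot fed by `HeegnerTwistSha.stubC_of_heegnerTwistShaAnSupply`: `ord_p #Ш_an = 0` on a Heegner twist pair).
* (w3 g10, landed while this file was in flight: `…EisensteinEndStateV19ShaPrimitivity` — `twistSupply_of_shaSupply` (C_Ш ⟹ C♭_Ш) and
  `bottomClassIndexLawFiveLe_of_prints4_of_mazurWiles_of_krizLi_of_shaSupply_of_sha_of_heegnerIndex`: crux ⟸ prints4 ∧ MW ∧ KL ∧ C_Ш ∧ B1-sha ∧ B1-prim,
  the Kolyvagin-reading END STATE with both supplies fed by C_Ш — not restated here.)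
* Companion `…HeegnerTwistShaSupplyOfStubC` (this seat): C ⟹ C_Ш♭ under `ToricPublishedInputs` + KL + CT, the iff C ⟺ C_Ш♭, and (P) ⟹ C_Ш♭.

CONDITIONAL by construction (audit: `proof.conditional`); credits nothing. beyond-print theorem: NO. BSD is not proved by any of this;
no summit statement is proved by this seat. References: [MazurWiles1984] Thm. 2; [KrizLi2019] Thm. 1.20, §8; [GrossZagier1986] I.(6.3);
[Cassels1962ArithmeticIV]; the LEAD g11 report (`Lines/eisenstein-resource-bdp-line-lead-g11.md`, ADDENDUM) and LEAD g12 STATUS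
2026-08-28T23:39:14Z (registry v20 «elementary currency»).
-/

set_option autoImplicit false
-- `…BirchSwinnertonDyer.BirchSwinnertonDyer.Theorems…` is the problem's mandated namespace (D-0017).
set_option linter.dupNamespace false

noncomputable section

open scoped Classical

namespace Summit.BirchSwinnertonDyer.BirchSwinnertonDyer.Theorems.PrintCFram.EisensteinEndStateV19ShaCurrency

open WeierstrassCurve NumberField IsDedekindDomain DirichletCharacter
  Literature.NumberTheory.EllipticCurves
  Literature.NumberTheory.EllipticCurves.ModularForms
  Literature.NumberTheory.EllipticCurves.Rank1Residual
  Literature.NumberTheory.EllipticCurves.KrizLi2019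
  Literature.NumberTheory.NumberFields
  Summit.BirchSwinnertonDyer.Rank1Residual
  Summit.BirchSwinnertonDyer.BirchSwinnertonDyer.Theorems.PrintCFram
  Summit.BirchSwinnertonDyer.BirchSwinnertonDyer.Theorems.PrintCFram.HeegnerTwistSha

/-! ## §1 The dictionary: unit field factor ⟺ `Ш[p]`-trivial Heegner twist pair -/

/-- **UNIT `K''`-FACTOR ⟺ `Ш[p]`-TRIVIAL HEEGNER TWIST PAIR.** For `W/ℚ` elliptic with CM, `p ≥ 5` CM-ramified, an odd datum
`(f, ψ, ω)` with `hss`, an imaginary quadratic `K` with Kronecker `ε_K`, and a globally minimal model `Wd` of `W^{(d_K)}` with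
`L(W^{(d_K)},1) ≠ 0`: the field factor `B_{1,(ψε_Kω⁻¹)~}` is a `p`-adic UNIT iff `Ш(Wd)[p] = 0` and `Ш(W₁)[p] = 0` for every globally
minimal CM-ramified `W₁` with a `p`-isogeny `Wd → W₁`. (⟹ Cassels–Tate + GZK, this seat's `twist_noPTorsion_pair_of_unit_fieldFactor`;
⟸ Mazur–Wiles Thm. 2 + GZK, `not_fieldFactor_le_of_twist_noPTorsion_pair`.) CONDITIONAL on `hMW`, `hGZK`, `hCT`; closes no stub.
[cite: MazurWiles1984, Thm. 2 (p. 216)] [cite: Cassels1962ArithmeticIV] [cite: KrizLi2019, Thm. 1.20 (p. 8) and §7.1 (p. 43)]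
[cite: GrossZagier1986, Thm. I.(6.3)] -/
theorem unit_fieldFactor_iff_twist_noPTorsion_pair {p : ℕ} [Fact p.Prime]
    (hMW : MazurWiles1984.thm2_card_oddChiClassGroup_eq_bernoulli)
    (hGZK : rank_eq_analyticRank_of_analyticRank_le_one) (hCT : exists_casselsTate_pairing (K := ℚ))
    (W : WeierstrassCurve ℚ) [W.IsElliptic] (hCM : W.HasCM) (hram : CMRamified W p) (h5 : 5 ≤ p)
    {f : ℕ} [NeZero f] (ψ : DirichletCharacter ℚ_[p] f) (ω : DirichletCharacter ℚ_[p] p)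
    (hψ : ψ.Odd) (hω : IsTeichmullerCharacter ω)
    (hss : ∀ ℓ : ℕ, ℓ.Prime → ¬ (ℓ ∣ p * W.conductorNorm ℤ) →
      ‖((W.LFunction ℓ : ℤ) : ℚ_[p]) - (ψ (ℓ : ZMod f) + ψ⁻¹ (ℓ : ZMod f) * ω (ℓ : ZMod p))‖ < 1)
    (K : Type) [Field K] [NumberField K] (hK : IsImaginaryQuadratic K)
    (εK : DirichletCharacter ℚ_[p] (NumberField.discr K).natAbs) (hεK : IsKroneckerCharacterOf K εK)
    (Wd : WeierstrassCurve ℚ) [Wd.IsElliptic] [Wd.IsGloballyMinimal]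
    (hC : ∃ C : VariableChange ℚ, C • W.quadraticTwist (NumberField.discr K : ℚ) = Wd)
    (hLt : (W.quadraticTwist (NumberField.discr K : ℚ)).entireLFunction 1 ≠ 0) :
    ¬ ‖bernoulliOnePrim (bernoulliCharTwo ψ εK ω)‖ ≤ (p : ℝ)⁻¹ ↔
      ((∀ c ∈ Wd.sha, p • c = 0 → c = 0) ∧
        ∀ (W₁ : WeierstrassCurve ℚ) [W₁.IsElliptic] [W₁.IsGloballyMinimal], W₁.HasCM → CMRamified W₁ p →
          (∃ φ : Isogeny Wd W₁, φ.degree = p) → ∀ c ∈ W₁.sha, p • c = 0 → c = 0) :=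
  ⟨fun hfld ↦ twist_noPTorsion_pair_of_unit_fieldFactor hCT hGZK W hCM hram h5 ψ ω hψ hω hss K hK εK hεK hfld Wd hC hLt,
    fun h ↦ not_fieldFactor_le_of_twist_noPTorsion_pair hMW hGZK W hCM hram h5 ψ ω hψ hω hss K hK εK hεK Wd hC hLt h.1
      (fun W₁ _ _ hCM₁ hram₁ hφ ↦ h.2 W₁ hCM₁ hram₁ hφ)⟩

/-! ## §2 The END STATE in Ш-currency -/

/-- **END STATE v19 IN Ш-CURRENCY: crux ⟸ prints4 ∧ Mazur–Wiles Thm 2 ∧ Kriz–Li Thm 1.20 ∧ C_Ш ∧ B1-level ∧ B1-sha.** LEAD g11's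
binders END STATE with its C slot fed by `HeegnerTwistSha.stubC_of_heegnerTwistShaSupply`: the analytic residue C now reads «every
rank-one class member has an admissible Heegner `K''` (Heegner for `N_W`, `d` odd `< −4`, `L(W^{(d)},1) ≠ 0`) and a globally minimal model
of the twist whose rational `p`-isogeny class is `Ш[p]`-trivial» — no character, no Bernoulli number, no `p`-adic `L`-function. With
B1-level and B1-sha, ALL research hypotheses of the line are statements about `Ш[p]` / the level of class members. CONDITIONAL by
construction; credits nothing; closes no stub; BSD is not proved by any of this. [cite: MazurWiles1984, Thm. 2 (p. 216)]
[cite: KrizLi2019, Thm. 1.20 (p. 8) and §8] [cite: GrossZagier1986, Thm. I.(6.3)] [cite: BurungaleKobayashiNakamuraOta2026, §1.4] -/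
theorem bottomClassIndexLawFiveLe_of_prints4_of_mazurWiles_of_krizLi_of_shaSupply_of_level_of_sha
    (hprints4 :
    Hsieh2014.thmA_exists_isHsiehLFunction_unrPeriod_anyLevel ∧
    LiuZhangZhang2018.thm151_thm153_modularCurve_heegnerVector_additive ∧
    Summit.BirchSwinnertonDyer.BirchSwinnertonDyer.Theses.UniversalToricDescent.ToricPublishedInputs ∧
    bsdTriple_of_hasCM_of_L_one_ne_zero)
    (hMW : MazurWiles1984.thm2_card_oddChiClassGroup_eq_bernoulli)
    (hKL : thm120_padicLogHeegner_unit_of_bernoulli)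
    (hShaSupply : ∀ (W : WeierstrassCurve ℚ) [W.IsElliptic] [W.IsGloballyMinimal] (p : ℕ) [Fact p.Prime],
      W.HasCM → CMRamified W p → 5 ≤ p → W.analyticRank = 1 →
      ∃ (K : Type) (_ : Field K) (_ : NumberField K), IsImaginaryQuadratic K ∧
        SatisfiesHeegnerHypothesis (W.conductorNorm ℤ) K ∧ Odd (NumberField.discr K) ∧ NumberField.discr K < -4 ∧
        (W.quadraticTwist (NumberField.discr K : ℚ)).entireLFunction 1 ≠ 0 ∧
        ∃ (Wd : WeierstrassCurve ℚ) (_ : Wd.IsElliptic) (_ : Wd.IsGloballyMinimal),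
          (∃ C : VariableChange ℚ, C • W.quadraticTwist (NumberField.discr K : ℚ) = Wd) ∧
          (∀ c ∈ Wd.sha, p • c = 0 → c = 0) ∧
          (∀ (W₁ : WeierstrassCurve ℚ) [W₁.IsElliptic] [W₁.IsGloballyMinimal], W₁.HasCM → CMRamified W₁ p →
            (∃ φ : Isogeny Wd W₁, φ.degree = p) → ∀ c ∈ W₁.sha, p • c = 0 → c = 0))
    (hLevel :
    ∀ (W : WeierstrassCurve ℚ) [W.IsElliptic] [W.IsGloballyMinimal] (p : ℕ) [Fact p.Prime],
      W.HasCM → CMRamified W p → 5 ≤ p → W.analyticRank = 1 →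
      ∀ P : W.toAffine.Point, ¬ IsOfFinAddOrder P →
        (∀ R : W.toAffine.Point, ∃ (k : ℤ) (T : W.toAffine.Point), IsOfFinAddOrder T ∧ R = k • P + T) →
        (∃ Q : (W.baseChange ℚ_[p]).toAffine.Point, p • Q = W.toPadicPoint p P) →
        BSDp W p)
    (hSha :
    ∀ (W : WeierstrassCurve ℚ) [W.IsElliptic] [W.IsGloballyMinimal] (p : ℕ) [Fact p.Prime],
      W.HasCM → CMRamified W p → 5 ≤ p → W.analyticRank = 1 →
      (∃ s ∈ W.sha, s ≠ 0 ∧ p • s = 0) → BSDp W p) :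
    Summit.BirchSwinnertonDyer.BirchSwinnertonDyer.Theses.PrintCFram.BottomClassIndexLawFiveLe := by
  obtain ⟨-, -, hGZK, -⟩ := hprints4.2.2.1
  exact EisensteinEndStateV19Binders.bottomClassIndexLawFiveLe_of_prints4_of_mazurWiles_of_krizLi_of_cover_of_level_of_sha
    hprints4 hMW hKL (stubC_of_heegnerTwistShaSupply hMW hGZK hShaSupply) hLevel hSha

/-- **END STATE v19 IN Ш-CURRENCY, ISOGENY-CLASS FORM** — as above with C_Ш's `Ш` clause stated as «`Ш(V/ℚ)[p] = 0` for every
elliptic `V/ℚ` isogenous over `ℚ` to the minimal twist model» (`HeegnerTwistSha.stubC_of_heegnerTwistShaSupply_isogenyClass`).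
CONDITIONAL by construction; credits nothing; closes no stub. [cite: MazurWiles1984, Thm. 2 (p. 216)] [cite: KrizLi2019, Thm. 1.20 (p. 8) and §8]
[cite: GrossZagier1986, Thm. I.(6.3)] -/
theorem bottomClassIndexLawFiveLe_of_prints4_of_mazurWiles_of_krizLi_of_shaSupplyIsogenyClass_of_level_of_sha
    (hprints4 :
    Hsieh2014.thmA_exists_isHsiehLFunction_unrPeriod_anyLevel ∧
    LiuZhangZhang2018.thm151_thm153_modularCurve_heegnerVector_additive ∧
    Summit.BirchSwinnertonDyer.BirchSwinnertonDyer.Theses.UniversalToricDescent.ToricPublishedInputs ∧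
    bsdTriple_of_hasCM_of_L_one_ne_zero)
    (hMW : MazurWiles1984.thm2_card_oddChiClassGroup_eq_bernoulli)
    (hKL : thm120_padicLogHeegner_unit_of_bernoulli)
    (hShaSupply : ∀ (W : WeierstrassCurve ℚ) [W.IsElliptic] [W.IsGloballyMinimal] (p : ℕ) [Fact p.Prime],
      W.HasCM → CMRamified W p → 5 ≤ p → W.analyticRank = 1 →
      ∃ (K : Type) (_ : Field K) (_ : NumberField K), IsImaginaryQuadratic K ∧
        SatisfiesHeegnerHypothesis (W.conductorNorm ℤ) K ∧ Odd (NumberField.discr K) ∧ NumberField.discr K < -4 ∧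
        (W.quadraticTwist (NumberField.discr K : ℚ)).entireLFunction 1 ≠ 0 ∧
        ∃ (Wd : WeierstrassCurve ℚ) (_ : Wd.IsElliptic) (_ : Wd.IsGloballyMinimal),
          (∃ C : VariableChange ℚ, C • W.quadraticTwist (NumberField.discr K : ℚ) = Wd) ∧
          ∀ (V : WeierstrassCurve ℚ) [V.IsElliptic], IsIsogenous Wd V → ∀ c ∈ V.sha, p • c = 0 → c = 0)
    (hLevel :
    ∀ (W : WeierstrassCurve ℚ) [W.IsElliptic] [W.IsGloballyMinimal] (p : ℕ) [Fact p.Prime],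
      W.HasCM → CMRamified W p → 5 ≤ p → W.analyticRank = 1 →
      ∀ P : W.toAffine.Point, ¬ IsOfFinAddOrder P →
        (∀ R : W.toAffine.Point, ∃ (k : ℤ) (T : W.toAffine.Point), IsOfFinAddOrder T ∧ R = k • P + T) →
        (∃ Q : (W.baseChange ℚ_[p]).toAffine.Point, p • Q = W.toPadicPoint p P) →
        BSDp W p)
    (hSha :
    ∀ (W : WeierstrassCurve ℚ) [W.IsElliptic] [W.IsGloballyMinimal] (p : ℕ) [Fact p.Prime],
      W.HasCM → CMRamified W p → 5 ≤ p → W.analyticRank = 1 →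
      (∃ s ∈ W.sha, s ≠ 0 ∧ p • s = 0) → BSDp W p) :
    Summit.BirchSwinnertonDyer.BirchSwinnertonDyer.Theses.PrintCFram.BottomClassIndexLawFiveLe := by
  obtain ⟨-, -, hGZK, -⟩ := hprints4.2.2.1
  exact EisensteinEndStateV19Binders.bottomClassIndexLawFiveLe_of_prints4_of_mazurWiles_of_krizLi_of_cover_of_level_of_sha
    hprints4 hMW hKL (stubC_of_heegnerTwistShaSupply_isogenyClass hMW hGZK hShaSupply) hLevel hSha

/-! ## §3 The END STATE in `L`-value (analytic Ш) currency -/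

/-- **END STATE v19 IN `L`-VALUE CURRENCY: crux ⟸ prints4 ∧ Mazur–Wiles Thm 2 ∧ Kriz–Li Thm 1.20 ∧ C_{Ш-an} ∧ B1-level ∧ B1-sha.**
LEAD g11's binders END STATE with its C slot fed by `HeegnerTwistSha.stubC_of_heegnerTwistShaAnSupply` (Burungale–Flach Cor. 2 is the fourth
conjunct of `prints4`, modularity a conjunct of `ToricPublishedInputs`): the analytic residue reads «every rank-one class member has an
admissible Heegner `K''` with `L(W^{(d)},1) ≠ 0` and a globally minimal twist model whose rational `p`-isogeny pair has `ord_p #Ш_an = 0`» —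
a statement about NORMALISED CENTRAL VALUES of the twist family. CONDITIONAL by construction; credits nothing; closes no stub; BSD is not
proved by any of this. [cite: MazurWiles1984, Thm. 2 (p. 216)] [cite: BurungaleFlach2024, Cor. 2] [cite: Miller2011LMS, Def. 1.1 (§1)]
[cite: KrizLi2019, Thm. 1.20 (p. 8) and §8] -/
theorem bottomClassIndexLawFiveLe_of_prints4_of_mazurWiles_of_krizLi_of_shaAnSupply_of_level_of_sha
    (hprints4 :
    Hsieh2014.thmA_exists_isHsiehLFunction_unrPeriod_anyLevel ∧
    LiuZhangZhang2018.thm151_thm153_modularCurve_heegnerVector_additive ∧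
    Summit.BirchSwinnertonDyer.BirchSwinnertonDyer.Theses.UniversalToricDescent.ToricPublishedInputs ∧
    bsdTriple_of_hasCM_of_L_one_ne_zero)
    (hMW : MazurWiles1984.thm2_card_oddChiClassGroup_eq_bernoulli)
    (hKL : thm120_padicLogHeegner_unit_of_bernoulli)
    (hShaAnSupply : ∀ (W : WeierstrassCurve ℚ) [W.IsElliptic] [W.IsGloballyMinimal] (p : ℕ) [Fact p.Prime],
      W.HasCM → CMRamified W p → 5 ≤ p → W.analyticRank = 1 →
      ∃ (K : Type) (_ : Field K) (_ : NumberField K), IsImaginaryQuadratic K ∧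
        SatisfiesHeegnerHypothesis (W.conductorNorm ℤ) K ∧ Odd (NumberField.discr K) ∧ NumberField.discr K < -4 ∧
        (W.quadraticTwist (NumberField.discr K : ℚ)).entireLFunction 1 ≠ 0 ∧
        ∃ (Wd : WeierstrassCurve ℚ) (_ : Wd.IsElliptic) (_ : Wd.IsGloballyMinimal),
          (∃ C : VariableChange ℚ, C • W.quadraticTwist (NumberField.discr K : ℚ) = Wd) ∧
          (∀ q : ℚ, shaAn Wd = (q : ℂ) → padicValRat p q = 0) ∧
          (∀ (W₁ : WeierstrassCurve ℚ) [W₁.IsElliptic] [W₁.IsGloballyMinimal], W₁.HasCM → CMRamified W₁ p →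
            (∃ φ : Isogeny Wd W₁, φ.degree = p) → ∀ q : ℚ, shaAn W₁ = (q : ℂ) → padicValRat p q = 0))
    (hLevel :
    ∀ (W : WeierstrassCurve ℚ) [W.IsElliptic] [W.IsGloballyMinimal] (p : ℕ) [Fact p.Prime],
      W.HasCM → CMRamified W p → 5 ≤ p → W.analyticRank = 1 →
      ∀ P : W.toAffine.Point, ¬ IsOfFinAddOrder P →
        (∀ R : W.toAffine.Point, ∃ (k : ℤ) (T : W.toAffine.Point), IsOfFinAddOrder T ∧ R = k • P + T) →
        (∃ Q : (W.baseChange ℚ_[p]).toAffine.Point, p • Q = W.toPadicPoint p P) →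
        BSDp W p)
    (hSha :
    ∀ (W : WeierstrassCurve ℚ) [W.IsElliptic] [W.IsGloballyMinimal] (p : ℕ) [Fact p.Prime],
      W.HasCM → CMRamified W p → 5 ≤ p → W.analyticRank = 1 →
      (∃ s ∈ W.sha, s ≠ 0 ∧ p • s = 0) → BSDp W p) :
    Summit.BirchSwinnertonDyer.BirchSwinnertonDyer.Theses.PrintCFram.BottomClassIndexLawFiveLe := by
  obtain ⟨-, -, -, hmod, -⟩ := hprints4.2.2.1
  exact EisensteinEndStateV19Binders.bottomClassIndexLawFiveLe_of_prints4_of_mazurWiles_of_krizLi_of_cover_of_level_of_sha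
    hprints4 hMW hKL (stubC_of_heegnerTwistShaAnSupply hprints4.2.2.2 hmod hMW hShaAnSupply) hLevel hSha

end Summit.BirchSwinnertonDyer.BirchSwinnertonDyer.Theorems.PrintCFram.EisensteinEndStateV19ShaCurrency

end
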